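import Mathlib
import HarnessLib
import Summits.Parity.GeneralizedHardyLittlewood.Theses.LiouvilleMAD
import Summits.Parity.GeneralizedHardyLittlewood.Theorems.FanDecorrelation.Negative.FanDecorrelationJointFloor
import Summits.Parity.GeneralizedHardyLittlewood.Theorems.DilatedChowla.Negative.DilatedChowlaMirror

/-!
# `FanDecorrelation` (stmt-Parity-13318): short-block variance along progressions is a sum of fans

Negation-side infrastructure for the crux `LiouvilleMAD.FanDecorrelation` (route LiouvilleMAD, rank 3):
the kernel of the FAN-ALONE Siegel mirror (`FanDecorrelationSiegelMirrorAlone`).  Written by the crux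
strategist (unit `cstrat-stmt-Parity-13318-p1`, tree work file `Cruxes/FanDecorrelation/StrategistMirror.lean`
@b4a7ca638d55, 2026-08-17); landed verbatim (split in two files, docstrings added) by the line lead c5.

For a dilation family `qν`, `1 ≤ ν ≤ V`, put `w(m) = Σ_ν λ(m·qν + c)` on `(M,2M]` and, for each modulus
`j ∈ [Q,2Q)` (`Q = ⌊√M⌋+1`), the SHORT BLOCK SUMS along the progressions mod `j`,
`B_j(m₀) = Σ_{s<K} w(m₀ + sj)`, `m₀ ∈ T_j = [M+1−(K−1)j, 2M]`.  Then
* `sum_B`:          `Σ_{m₀∈T_j} B_j(m₀) = K · Σ_m w(m)` (every `m` lies in exactly `K` blocks);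
* `card_T`:         `#T_j = M + (K−1)j`;
* `sum_j_sum_B_sq`: `Σ_j Σ_{T_j} B_j² = Σ_{s,s'<K} Σ_{ν,ν'≤V} fan c (qν) (qν') M (s − s')` — the block variance
  summed over the moduli IS a signed sum of the crux's fans (tree `fan`, `fanDecorrelation_iff`), including the
  lag `k = s − s' = 0` and the pairs `ν = ν'`;
* `abs_fan_le`:     the trivial bound `|fan| ≤ Q·M` (used for the `k = 0` and `ν = ν'` fans downstream).
This corrects the belief recorded in `Cruxes/FanDecorrelation/Disproof.lean` (c) that no positivity is available
for fans: the Fejér-weighted sum over `k` of fans is a block variance.  [folklore]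
-/

noncomputable section

namespace Summit.Parity.GeneralizedHardyLittlewood.Theorems.FanDecorrelation.Negative.BlockVariance

open Finset
open Summit.Parity.GeneralizedHardyLittlewood.Theses.LiouvilleMAD (FanDecorrelation)
open Summit.Parity.GeneralizedHardyLittlewood.Theorems.DilatedTableChowla.Negative (L abs_L_le_one)
open Summit.Parity.GeneralizedHardyLittlewood.Theorems.DilatedChowla.Negative (P)
open Summit.Parity.GeneralizedHardyLittlewood.Theorems.FanDecorrelation.Negative (fan fanDecorrelation_iff)

/-! ## §1 Lag correlations and the trivial bounds -/

/-- The lag correlation `X c n n' M d = Σ_{(m,m')∈(M,2M]², m−m'=d} λ(mn+c)λ(m'n'+c)` (the inner sum of `fan`). -/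
def X (c : ℤ) (n n' M : ℕ) (d : ℤ) : ℝ :=
  ∑ p ∈ (Ioc M (2 * M) ×ˢ Ioc M (2 * M)).filter (fun p : ℕ × ℕ => (p.1 : ℤ) - p.2 = d),
    L ((p.1 : ℤ) * n + c) * L ((p.2 : ℤ) * n' + c)

/-- A fan is the sum of its lag correlations over the lags `kj`, `j ∈ [Q, 2Q)`. -/
theorem fan_eq_sum_X (c : ℤ) (n n' M : ℕ) (k : ℤ) :
    fan c n n' M k = ∑ j ∈ Ico (Nat.sqrt M + 1) (2 * (Nat.sqrt M + 1)), X c n n' M (k * j) := rfl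

/-- The lag correlation as a double sum with an indicator. -/
theorem X_eq_ite (c : ℤ) (n n' M : ℕ) (d : ℤ) :
    X c n n' M d = ∑ m ∈ Ioc M (2 * M), ∑ m' ∈ Ioc M (2 * M),
      if (m : ℤ) - m' = d then L ((m : ℤ) * n + c) * L ((m' : ℤ) * n' + c) else 0 := by
  unfold X
  rw [sum_filter, sum_product]

/-- Each lag correlation has at most `M` nonzero terms, each of absolute value `≤ 1`. -/
theorem abs_X_le (c : ℤ) (n n' M : ℕ) (d : ℤ) : |X c n n' M d| ≤ M := by
  unfold X
  set F := (Ioc M (2 * M) ×ˢ Ioc M (2 * M)).filter (fun p : ℕ × ℕ => (p.1 : ℤ) - p.2 = d) with hF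
  have hcard : F.card ≤ (Ioc M (2 * M)).card := by
    refine Finset.card_le_card_of_injOn (fun p : ℕ × ℕ => p.1) ?_ ?_
    · intro p hp
      have hp' := (mem_filter.mp hp).1
      exact (mem_product.mp hp').1
    · intro p hp p' hp' heq
      have h1 : (p.1 : ℤ) - p.2 = d := (mem_filter.mp hp).2
      have h2 : (p'.1 : ℤ) - p'.2 = d := (mem_filter.mp hp').2
      simp only at heq
      have h3 : (p.2 : ℤ) = p'.2 := by
        have : (p.1 : ℤ) = p'.1 := by exact_mod_cast heq
        linarith
      exact Prod.ext heq (by exact_mod_cast h3)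
  calc |∑ p ∈ F, L ((p.1 : ℤ) * n + c) * L ((p.2 : ℤ) * n' + c)|
      ≤ ∑ p ∈ F, |L ((p.1 : ℤ) * n + c) * L ((p.2 : ℤ) * n' + c)| := abs_sum_le_sum_abs _ _
    _ ≤ ∑ _p ∈ F, (1 : ℝ) := by
        refine sum_le_sum fun p _ => ?_
        rw [abs_mul]
        have h1 := abs_L_le_one ((p.1 : ℤ) * n + c)
        have h2 := abs_L_le_one ((p.2 : ℤ) * n' + c)
        have h0 : 0 ≤ |L ((p.1 : ℤ) * n + c)| := abs_nonneg _
        nlinarith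
    _ = F.card := by simp
    _ ≤ (Ioc M (2 * M)).card := by exact_mod_cast hcard
    _ = M := by simp; omega

/-- Trivial bound for every fan: `|fan c n n' M k| ≤ Q·M`, `Q = ⌊√M⌋+1`. -/
theorem abs_fan_le (c : ℤ) (n n' M : ℕ) (k : ℤ) :
    |fan c n n' M k| ≤ ((Nat.sqrt M : ℝ) + 1) * M := by
  rw [fan_eq_sum_X]
  calc |∑ j ∈ Ico (Nat.sqrt M + 1) (2 * (Nat.sqrt M + 1)), X c n n' M (k * j)|
      ≤ ∑ j ∈ Ico (Nat.sqrt M + 1) (2 * (Nat.sqrt M + 1)), |X c n n' M (k * j)| :=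
        abs_sum_le_sum_abs _ _
    _ ≤ ∑ _j ∈ Ico (Nat.sqrt M + 1) (2 * (Nat.sqrt M + 1)), (M : ℝ) :=
        sum_le_sum fun j _ => abs_X_le c n n' M _
    _ = ((Nat.sqrt M : ℝ) + 1) * M := by
        rw [sum_const, nsmul_eq_mul]
        have hc : (Ico (Nat.sqrt M + 1) (2 * (Nat.sqrt M + 1))).card = Nat.sqrt M + 1 := by
          rw [Nat.card_Ico]; omega
        rw [hc]
        push_cast
        ring

/-! ## §2 The family sum and the short block sums -/

/-- The family one-point function `w(m) = Σ_{ν=1}^{V} λ(m·qν + c)`. -/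
def w (c : ℤ) (q V m : ℕ) : ℝ := ∑ ν ∈ Icc 1 V, L ((m : ℤ) * ((q * ν : ℕ) : ℤ) + c)

/-- `Σ_m w(m) = Σ_ν P c (qν) M`. -/
theorem sum_w_eq (c : ℤ) (q V M : ℕ) :
    ∑ m ∈ Ioc M (2 * M), w c q V m = ∑ ν ∈ Icc 1 V, P c (q * ν) M := by
  unfold w P
  exact sum_comm

/-- The block-start range `T = [M+1−(K−1)j, 2M] ⊂ ℤ`. -/
def T (M K j : ℕ) : Finset ℤ := Icc ((M : ℤ) + 1 - ((K : ℤ) - 1) * j) (2 * M)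

/-- The short block sum `B_j(m₀) = Σ_{s<K} Σ_{m∈(M,2M]} [m = m₀ + sj] w(m)`. -/
def B (c : ℤ) (M q V K j : ℕ) (m₀ : ℤ) : ℝ :=
  ∑ s ∈ range K, ∑ m ∈ Ioc M (2 * M), if (m : ℤ) = m₀ + (s : ℤ) * (j : ℤ) then w c q V m else 0

/-- Every `m ∈ (M,2M]` shifted back by `s·j`, `s < K`, is an admissible block start. -/
theorem mem_T {M K j m s : ℕ} (hm : m ∈ Ioc M (2 * M)) (hs : s ∈ range K) :
    (m : ℤ) - (s : ℤ) * (j : ℤ) ∈ T M K j := by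
  rw [mem_Ioc] at hm
  rw [mem_range] at hs
  rw [T, mem_Icc]
  have hs' : (s : ℤ) ≤ (K : ℤ) - 1 := by
    have : s + 1 ≤ K := hs
    have : ((s + 1 : ℕ) : ℤ) ≤ K := by exact_mod_cast this
    push_cast at this
    linarith
  have hj : (0 : ℤ) ≤ j := by positivity
  have hm1 : (M : ℤ) + 1 ≤ m := by exact_mod_cast hm.1
  have hm2 : (m : ℤ) ≤ 2 * M := by exact_mod_cast hm.2
  have hs0 : (0 : ℤ) ≤ s := by positivity
  constructor
  · nlinarith
  · nlinarith

/-- `#T_j = M + (K−1)·j` (as a real number). -/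
theorem card_T (M K j : ℕ) (hK : 1 ≤ K) :
    ((T M K j).card : ℝ) = M + ((K : ℝ) - 1) * j := by
  have hK' : (0 : ℤ) ≤ (K : ℤ) - 1 := by
    have : ((1 : ℕ) : ℤ) ≤ K := by exact_mod_cast hK
    push_cast at this
    linarith
  have hj : (0 : ℤ) ≤ j := by positivity
  have hnn : (0 : ℤ) ≤ (M : ℤ) + ((K : ℤ) - 1) * j := by positivity
  have hz : ((T M K j).card : ℤ) = (M : ℤ) + ((K : ℤ) - 1) * j := by
    rw [T, Int.card_Icc]
    rw [Int.toNat_of_nonneg (by linarith)]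
    ring
  have : (((T M K j).card : ℤ) : ℝ) = ((M : ℤ) + ((K : ℤ) - 1) * j : ℤ) := by exact_mod_cast hz
  push_cast at this
  exact this

/-- Elementary re-indexing of an indicator (all atoms integers). -/
theorem ite_shift (a : ℝ) (m m₀ d : ℤ) :
    (if m = m₀ + d then a else 0) = if m₀ = m - d then a else 0 := by
  by_cases h : m = m₀ + d
  · have h0 : m₀ = m - d := by omega
    rw [if_pos h, if_pos h0]
  · have h0 : ¬ (m₀ = m - d) := fun h0 => h (by omega)
    rw [if_neg h, if_neg h0]

/-- `Σ_{m₀∈T} B_j(m₀) = K · Σ_m w(m)`: every `m ∈ (M,2M]` lies in exactly `K` blocks. -/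
theorem sum_B (c : ℤ) (M q V K j : ℕ) :
    ∑ m₀ ∈ T M K j, B c M q V K j m₀ = (K : ℝ) * ∑ m ∈ Ioc M (2 * M), w c q V m := by
  unfold B
  rw [sum_comm]
  have hinner : ∀ s ∈ range K,
      ∑ m₀ ∈ T M K j, ∑ m ∈ Ioc M (2 * M),
        (if (m : ℤ) = m₀ + (s : ℤ) * (j : ℤ) then w c q V m else 0) =
      ∑ m ∈ Ioc M (2 * M), w c q V m := by
    intro s hs
    rw [sum_comm]
    refine sum_congr rfl fun m hm => ?_
    have h1 : ∀ m₀ : ℤ, (if (m : ℤ) = m₀ + (s : ℤ) * (j : ℤ) then w c q V m else 0) =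
        if m₀ = (m : ℤ) - (s : ℤ) * (j : ℤ) then w c q V m else 0 :=
      fun m₀ => ite_shift _ _ _ _
    simp_rw [h1]
    rw [sum_ite_eq' (T M K j) ((m : ℤ) - (s : ℤ) * (j : ℤ)) (fun _ => w c q V m), if_pos (mem_T hm hs)]
  rw [sum_congr rfl hinner, sum_const, card_range, nsmul_eq_mul]

/-- Pulling a finite double sum out of an indicator. -/
theorem ite_sum_sum {α β : Type*} (p : Prop) [Decidable p] (A : Finset α) (Bs : Finset β)
    (f : α → β → ℝ) :
    (if p then ∑ x ∈ A, ∑ y ∈ Bs, f x y else 0) = ∑ x ∈ A, ∑ y ∈ Bs, if p then f x y else 0 := by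
  split_ifs <;> simp

/-- Four-fold sum swap: `(m, m')` outside ↔ `(ν, ν')` outside. -/
theorem sum_comm4 {α β : Type*} (A : Finset α) (Bs : Finset β) (F : α → α → β → β → ℝ) :
    ∑ m ∈ A, ∑ m' ∈ A, ∑ ν ∈ Bs, ∑ ν' ∈ Bs, F m m' ν ν' =
      ∑ ν ∈ Bs, ∑ ν' ∈ Bs, ∑ m ∈ A, ∑ m' ∈ A, F m m' ν ν' := by
  calc ∑ m ∈ A, ∑ m' ∈ A, ∑ ν ∈ Bs, ∑ ν' ∈ Bs, F m m' ν ν'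
      = ∑ m ∈ A, ∑ ν ∈ Bs, ∑ m' ∈ A, ∑ ν' ∈ Bs, F m m' ν ν' := by
        refine sum_congr rfl fun m _ => ?_
        exact sum_comm
    _ = ∑ ν ∈ Bs, ∑ m ∈ A, ∑ m' ∈ A, ∑ ν' ∈ Bs, F m m' ν ν' := sum_comm
    _ = ∑ ν ∈ Bs, ∑ m ∈ A, ∑ ν' ∈ Bs, ∑ m' ∈ A, F m m' ν ν' := by
        refine sum_congr rfl fun ν _ => sum_congr rfl fun m _ => ?_
        exact sum_comm
    _ = ∑ ν ∈ Bs, ∑ ν' ∈ Bs, ∑ m ∈ A, ∑ m' ∈ A, F m m' ν ν' := by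
        refine sum_congr rfl fun ν _ => ?_
        exact sum_comm

/-- The product of two block indicators, summed over the block start, is a lag indicator. -/
theorem sum_T_ite_mul_ite (c : ℤ) (M q V K j : ℕ) {s s' m m' : ℕ}
    (hs : s ∈ range K) (hm : m ∈ Ioc M (2 * M)) :
    ∑ m₀ ∈ T M K j,
      (if (m : ℤ) = m₀ + (s : ℤ) * (j : ℤ) then w c q V m else 0) *
        (if (m' : ℤ) = m₀ + (s' : ℤ) * (j : ℤ) then w c q V m' else 0) =
      if (m : ℤ) - m' = ((s : ℤ) - s') * (j : ℤ) then w c q V m * w c q V m' else 0 := by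
  have h1 : ∀ m₀ : ℤ,
      (if (m : ℤ) = m₀ + (s : ℤ) * (j : ℤ) then w c q V m else 0) *
        (if (m' : ℤ) = m₀ + (s' : ℤ) * (j : ℤ) then w c q V m' else 0) =
      if m₀ = (m : ℤ) - (s : ℤ) * (j : ℤ) then
        (if (m' : ℤ) = m₀ + (s' : ℤ) * (j : ℤ) then w c q V m * w c q V m' else 0) else 0 := by
    intro m₀
    by_cases h : (m : ℤ) = m₀ + (s : ℤ) * (j : ℤ)
    · have h0 : m₀ = (m : ℤ) - (s : ℤ) * (j : ℤ) := by linarith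
      rw [if_pos h, if_pos h0]
      by_cases h' : (m' : ℤ) = m₀ + (s' : ℤ) * (j : ℤ)
      · rw [if_pos h', if_pos h']
      · rw [if_neg h', if_neg h', mul_zero]
    · have h0 : ¬ (m₀ = (m : ℤ) - (s : ℤ) * (j : ℤ)) := fun h0 => h (by linarith)
      rw [if_neg h, if_neg h0, zero_mul]
  simp_rw [h1]
  rw [sum_ite_eq' (T M K j) ((m : ℤ) - (s : ℤ) * (j : ℤ)), if_pos (mem_T hm hs)]
  have hiff : ((m' : ℤ) = (m : ℤ) - (s : ℤ) * (j : ℤ) + (s' : ℤ) * (j : ℤ)) ↔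
      ((m : ℤ) - m' = ((s : ℤ) - s') * (j : ℤ)) := by
    rw [sub_mul]
    constructor
    · intro h; linarith
    · intro h; linarith
  by_cases h : (m' : ℤ) = (m : ℤ) - (s : ℤ) * (j : ℤ) + (s' : ℤ) * (j : ℤ)
  · rw [if_pos h, if_pos (hiff.mp h)]
  · rw [if_neg h, if_neg (fun h' => h (hiff.mpr h'))]

/-- EXPANSION at one modulus: `Σ_{m₀∈T_j} B_j(m₀)² = Σ_{s,s'<K} Σ_{ν,ν'} X c (qν) (qν') M ((s−s')j)`. -/
theorem sum_B_sq (c : ℤ) (M q V K j : ℕ) :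
    ∑ m₀ ∈ T M K j, (B c M q V K j m₀) ^ 2 =
      ∑ s ∈ range K, ∑ s' ∈ range K, ∑ ν ∈ Icc 1 V, ∑ ν' ∈ Icc 1 V,
        X c (q * ν) (q * ν') M (((s : ℤ) - s') * (j : ℤ)) := by
  -- Step 1: expand the square and move the block start inside.
  have step1 : ∑ m₀ ∈ T M K j, (B c M q V K j m₀) ^ 2 =
      ∑ s ∈ range K, ∑ s' ∈ range K, ∑ m₀ ∈ T M K j,
        (∑ m ∈ Ioc M (2 * M), if (m : ℤ) = m₀ + (s : ℤ) * (j : ℤ) then w c q V m else 0) *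
          (∑ m' ∈ Ioc M (2 * M), if (m' : ℤ) = m₀ + (s' : ℤ) * (j : ℤ) then w c q V m' else 0) := by
    calc ∑ m₀ ∈ T M K j, (B c M q V K j m₀) ^ 2
        = ∑ m₀ ∈ T M K j, ∑ s ∈ range K, ∑ s' ∈ range K,
            (∑ m ∈ Ioc M (2 * M), if (m : ℤ) = m₀ + (s : ℤ) * (j : ℤ) then w c q V m else 0) *
              (∑ m' ∈ Ioc M (2 * M),
                if (m' : ℤ) = m₀ + (s' : ℤ) * (j : ℤ) then w c q V m' else 0) := by
          refine sum_congr rfl fun m₀ _ => ?_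
          rw [B, sq, sum_mul_sum]
      _ = ∑ s ∈ range K, ∑ m₀ ∈ T M K j, ∑ s' ∈ range K,
            (∑ m ∈ Ioc M (2 * M), if (m : ℤ) = m₀ + (s : ℤ) * (j : ℤ) then w c q V m else 0) *
              (∑ m' ∈ Ioc M (2 * M),
                if (m' : ℤ) = m₀ + (s' : ℤ) * (j : ℤ) then w c q V m' else 0) := sum_comm
      _ = _ := by
          refine sum_congr rfl fun s _ => ?_
          exact sum_comm
  rw [step1]
  refine sum_congr rfl fun s hs => sum_congr rfl fun s' hs' => ?_
  -- Step 2: for fixed (s, s'), evaluate the block-start sum.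
  calc ∑ m₀ ∈ T M K j,
        (∑ m ∈ Ioc M (2 * M), if (m : ℤ) = m₀ + (s : ℤ) * (j : ℤ) then w c q V m else 0) *
          (∑ m' ∈ Ioc M (2 * M), if (m' : ℤ) = m₀ + (s' : ℤ) * (j : ℤ) then w c q V m' else 0)
      = ∑ m₀ ∈ T M K j, ∑ m ∈ Ioc M (2 * M), ∑ m' ∈ Ioc M (2 * M),
          (if (m : ℤ) = m₀ + (s : ℤ) * (j : ℤ) then w c q V m else 0) *
            (if (m' : ℤ) = m₀ + (s' : ℤ) * (j : ℤ) then w c q V m' else 0) := by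
        refine sum_congr rfl fun m₀ _ => ?_
        rw [sum_mul_sum]
    _ = ∑ m ∈ Ioc M (2 * M), ∑ m₀ ∈ T M K j, ∑ m' ∈ Ioc M (2 * M),
          (if (m : ℤ) = m₀ + (s : ℤ) * (j : ℤ) then w c q V m else 0) *
            (if (m' : ℤ) = m₀ + (s' : ℤ) * (j : ℤ) then w c q V m' else 0) := sum_comm
    _ = ∑ m ∈ Ioc M (2 * M), ∑ m' ∈ Ioc M (2 * M), ∑ m₀ ∈ T M K j,
          (if (m : ℤ) = m₀ + (s : ℤ) * (j : ℤ) then w c q V m else 0) *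
            (if (m' : ℤ) = m₀ + (s' : ℤ) * (j : ℤ) then w c q V m' else 0) := by
        refine sum_congr rfl fun m _ => ?_
        exact sum_comm
    _ = ∑ m ∈ Ioc M (2 * M), ∑ m' ∈ Ioc M (2 * M),
          (if (m : ℤ) - m' = ((s : ℤ) - s') * (j : ℤ) then w c q V m * w c q V m' else 0) := by
        refine sum_congr rfl fun m hm => sum_congr rfl fun m' _ => ?_
        exact sum_T_ite_mul_ite c M q V K j hs hm
    _ = ∑ m ∈ Ioc M (2 * M), ∑ m' ∈ Ioc M (2 * M), ∑ ν ∈ Icc 1 V, ∑ ν' ∈ Icc 1 V,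
          (if (m : ℤ) - m' = ((s : ℤ) - s') * (j : ℤ) then
            L ((m : ℤ) * ((q * ν : ℕ) : ℤ) + c) * L ((m' : ℤ) * ((q * ν' : ℕ) : ℤ) + c) else 0) := by
        refine sum_congr rfl fun m _ => sum_congr rfl fun m' _ => ?_
        rw [← ite_sum_sum]
        congr 1
        rw [w, w, sum_mul_sum]
    _ = ∑ ν ∈ Icc 1 V, ∑ ν' ∈ Icc 1 V, ∑ m ∈ Ioc M (2 * M), ∑ m' ∈ Ioc M (2 * M),
          (if (m : ℤ) - m' = ((s : ℤ) - s') * (j : ℤ) then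
            L ((m : ℤ) * ((q * ν : ℕ) : ℤ) + c) * L ((m' : ℤ) * ((q * ν' : ℕ) : ℤ) + c) else 0) :=
        sum_comm4 _ _ _
    _ = ∑ ν ∈ Icc 1 V, ∑ ν' ∈ Icc 1 V, X c (q * ν) (q * ν') M (((s : ℤ) - s') * (j : ℤ)) := by
        refine sum_congr rfl fun ν _ => sum_congr rfl fun ν' _ => ?_
        rw [X_eq_ite]

/-- EXPANSION summed over the moduli: `Σ_j Σ_{T_j} B_j² = Σ_{s,s'} Σ_{ν,ν'} fan c (qν) (qν') M (s − s')`. -/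
theorem sum_j_sum_B_sq (c : ℤ) (M q V K : ℕ) :
    ∑ j ∈ Ico (Nat.sqrt M + 1) (2 * (Nat.sqrt M + 1)), ∑ m₀ ∈ T M K j, (B c M q V K j m₀) ^ 2 =
      ∑ s ∈ range K, ∑ s' ∈ range K, ∑ ν ∈ Icc 1 V, ∑ ν' ∈ Icc 1 V,
        fan c (q * ν) (q * ν') M ((s : ℤ) - s') := by
  calc ∑ j ∈ Ico (Nat.sqrt M + 1) (2 * (Nat.sqrt M + 1)), ∑ m₀ ∈ T M K j, (B c M q V K j m₀) ^ 2
      = ∑ j ∈ Ico (Nat.sqrt M + 1) (2 * (Nat.sqrt M + 1)),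
          ∑ s ∈ range K, ∑ s' ∈ range K, ∑ ν ∈ Icc 1 V, ∑ ν' ∈ Icc 1 V,
            X c (q * ν) (q * ν') M (((s : ℤ) - s') * (j : ℤ)) :=
        sum_congr rfl fun j _ => sum_B_sq c M q V K j
    _ = ∑ s ∈ range K, ∑ j ∈ Ico (Nat.sqrt M + 1) (2 * (Nat.sqrt M + 1)),
          ∑ s' ∈ range K, ∑ ν ∈ Icc 1 V, ∑ ν' ∈ Icc 1 V,
            X c (q * ν) (q * ν') M (((s : ℤ) - s') * (j : ℤ)) := sum_comm
    _ = ∑ s ∈ range K, ∑ s' ∈ range K, ∑ j ∈ Ico (Nat.sqrt M + 1) (2 * (Nat.sqrt M + 1)),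
          ∑ ν ∈ Icc 1 V, ∑ ν' ∈ Icc 1 V,
            X c (q * ν) (q * ν') M (((s : ℤ) - s') * (j : ℤ)) := by
        refine sum_congr rfl fun s _ => ?_
        exact sum_comm
    _ = ∑ s ∈ range K, ∑ s' ∈ range K, ∑ ν ∈ Icc 1 V,
          ∑ j ∈ Ico (Nat.sqrt M + 1) (2 * (Nat.sqrt M + 1)), ∑ ν' ∈ Icc 1 V,
            X c (q * ν) (q * ν') M (((s : ℤ) - s') * (j : ℤ)) := by
        refine sum_congr rfl fun s _ => sum_congr rfl fun s' _ => ?_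
        exact sum_comm
    _ = ∑ s ∈ range K, ∑ s' ∈ range K, ∑ ν ∈ Icc 1 V, ∑ ν' ∈ Icc 1 V,
          ∑ j ∈ Ico (Nat.sqrt M + 1) (2 * (Nat.sqrt M + 1)),
            X c (q * ν) (q * ν') M (((s : ℤ) - s') * (j : ℤ)) := by
        refine sum_congr rfl fun s _ => sum_congr rfl fun s' _ => sum_congr rfl fun ν _ => ?_
        exact sum_comm
    _ = _ := by
        refine sum_congr rfl fun s _ => sum_congr rfl fun s' _ =>
          sum_congr rfl fun ν _ => sum_congr rfl fun ν' _ => ?_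
        rw [fan_eq_sum_X]

end Summit.Parity.GeneralizedHardyLittlewood.Theorems.FanDecorrelation.Negative.BlockVariance

end
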